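import Literature.NumberTheory.LFunctions.BondarenkoHeap2026Section6
import Literature.NumberTheory.LFunctions.BondarenkoHeap2026Sections3to5
import Literature.NumberTheory.LFunctions.MertensElementary
import HarnessLib

/-!
# Bondarenko–Heap 2026, §6.2: the reduction of `𝒪𝒟` to the correlation sums `E(K,M,R)`, and
# Proposition 6 from the three ranges (23), (27), (40)

Topic `Literature/NumberTheory/LFunctions`, namespace
`Literature.NumberTheory.LFunctions.BondarenkoHeap2026`. The bridge between the §5 object
`𝒪𝒟 = offDiagOD c w B ρ χ` (sibling `BondarenkoHeap2026Sections3to5`, Proposition 6 = `prop6`) and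
the §6 correlation sums `E(K,M,R) = corrSumE` (sibling `BondarenkoHeap2026Section6`), from
A. Bondarenko, W. Heap, arXiv:2608.07399v1, §6.2 (authors' TeX l.742–847) and the last sentence of
§6 (l.1309). RH-free; no `ζ`, no Siegel zero.

* `offDiag_reduction` — the §6.2 REDUCTION as ONE named fact (dyadic partition of unity in
  `k, m, r`, expansion of `G₀` and `(1 + r/km)^{−1/2} log^j(1 + r/km)`, separation of variables by a
  triple inverse Mellin transform truncated at height `q^ε` with `c = ε`, l.749–836): "We are thus
  required to show that the sum `E(K,M,R)` has a fixed power saving, `q^η` say, over `KM`. From this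
  it will follow, after integrating, and then summing the `≪ (log T)^{O(1)}` partitions, that
  `𝒪𝒟 ≪ q^ε T / q^η`" (l.838–845). Typed: a power saving `q^{−θ}` for `E` on all admissible scales
  (`CorrSumPowerSaving ρ.δ θ`, which quantifies over both signs of `r` — "the argument for `r < 0`
  being similar", l.749 — and over every implied constant of `R ≪ KM/T`, `KM ≪ L` and every family
  of derivative constants of the weights) gives, for every `ε > 0`, `|𝒪𝒟| ≤ C q^ε T q^{−θ}` for
  `q ≥ q₀`. [claim, under review]
* `prop6_of_reduction_of_ranges` — **Proposition 6 as a THEOREM** from `offDiag_reduction` and the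
  three range facts `rangeI_bound` (23), `rangeII_bound` (27), `rangeIII_bound` (40) — the last two
  themselves theorems over Lemmas 7–10 (sibling `…Section6Proofs`): "Combining the power savings
  from all three ranges: (23), (27) and (40) gives Proposition 6" (l.1309), with the step
  "`q^ε T/q^η = o(T φ(q)/q · log T)` on taking `ε` sufficiently small in terms of `η`" (l.845)
  supplied by the tree's `φ(q)/q ≫ 1/log log q` (`MertensBound.exists_lt_totient_div_self`).

## References

* [BondarenkoHeap2026] arXiv:2608.07399v1, §6.2 (TeX l.742–847), §6.5 last sentence (l.1309),
  Proposition 6 (l.644–648).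
* [HardyWright2008] Thm 328 (the totient lower bound, via the tree's `MertensElementary`).
-/

noncomputable section

open scoped ArithmeticFunction.vonMangoldt

namespace Literature.NumberTheory.LFunctions.BondarenkoHeap2026

/-- **§6.2 reduction of `𝒪𝒟` to a power saving for `E(K,M,R)`** (TeX l.742–847): for the data of
§2.3 — `c > 0`, a bump `w`, `B`, a resonator datum `ρ` (`0 < δ < 10^{−2}`, `T = q^{7/3+δ}`,
`L = q^{17/6}`) — after the dyadic partition of unity `∑_X ω(x/X)² = 1` in `k, m, r`, the
expansion of `G₀(log(km+r)/log L)` and of `KM(km(km+r))^{−1/2}`, and the separation of variables by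
the inverse Mellin transform truncated at height `q^ε` (`c = ε`), `𝒪𝒟` is a sum of
`≪ (log T)^{O(1)}` terms `(q^ε T/KM) ∑_{k,m,r} a_k Λ(k) b_m c_r χ(m)χ(km+r)` with `1`-bounded smooth
weights on `[K,2K]`, `[M,2M]`, `[R,2R]` of derivatives `≪ q^ε`, `R ≪ KM/T`, `KM ≪ L`, up to
`O(T^{−C})`; hence "We are thus required to show that the sum `E(K,M,R)` has a fixed power saving,
`q^η` say, over `KM`. From this it will follow, after integrating, and then summing the
`≪ (log T)^{O(1)}` partitions, that `𝒪𝒟 ≪ q^ε T/q^η`". Typed: `CorrSumPowerSaving ρ.δ θ` (both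
signs of `r`, every implied constant `C₀`, every family `A` of derivative constants, some loss
`q^{ε₁}`) implies, for every `ε > 0`, `|𝒪𝒟| ≤ C q^ε · T · q^{−θ}` for `q ≥ q₀`, `χ` the primitive
quadratic character mod `q`. Named fact (Mellin analysis not in the tree).
[claim: BondarenkoHeap2026, status: under-review] -/
def offDiag_reduction : Prop :=
  ∀ (c : ℝ), 0 < c → ∀ (w : Bump) (B : ℕ) (ρ : Resonator) (θ : ℝ), 0 < θ →
    CorrSumPowerSaving ρ.δ θ →
    ∀ ε : ℝ, 0 < ε → ∃ C : ℝ, 0 < C ∧ ∃ q₀ : ℕ,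
      ∀ (q : ℕ) [NeZero q] (χ : DirichletCharacter ℂ q), q₀ ≤ q → χ.IsPrimitive → χ.IsQuadratic →
        |offDiagOD c w B ρ χ| ≤ C * (q : ℝ) ^ ε * ρ.T q * (q : ℝ) ^ (-θ)

/-- **Proposition 6 from the §6.2 reduction and the three ranges** ("Combining the power savings
from all three ranges: (23), (27) and (40) gives Proposition 6", TeX l.1309; "`𝒪𝒟 ≪ q^ε T/q^η =
o(T φ(q)/q · log T)` on taking `ε` sufficiently small in terms of `η`", l.845): PROVED from the
named facts `offDiag_reduction`, `rangeI_bound`, `rangeII_bound`, `rangeIII_bound` — the uniform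
saving `q^{−δ/40}` of `corrSumPowerSaving_of_ranges`, `ε = δ/80`, and `φ(q)/q > δ₀/log log q`
(`MertensBound.exists_lt_totient_div_self`) with `log log q ≤ log q ≤ log T`.
[cite: BondarenkoHeap2026, Proposition 6 and §6.5, TeX l.644–648, l.845, l.1309] -/
theorem prop6_of_reduction_of_ranges (hred : offDiag_reduction) (h₁ : rangeI_bound)
    (h₂ : rangeII_bound) (h₃ : rangeIII_bound) : prop6 := by
  intro c hc w B ρ η hη
  have hδ := ρ.δ_pos
  have hδ' := ρ.δ_lt
  have hPS : CorrSumPowerSaving ρ.δ (ρ.δ / 40) := corrSumPowerSaving_of_ranges h₁ h₂ h₃ hδ hδ'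
  obtain ⟨C, hC, q₀, H⟩ :=
    hred c hc w B ρ (ρ.δ / 40) (by positivity) hPS (ρ.δ / 80) (by positivity)
  obtain ⟨δ₀, hδ₀, Hφ⟩ := MertensBound.exists_lt_totient_div_self
  -- threshold: `q ≥ q₀`, `q ≥ 3`, and `q ≥ (C/(η δ₀))^{80/δ}` (so that `C q^{−δ/80} ≤ η δ₀`)
  set X : ℝ := (C / (η * δ₀)) ^ (80 / ρ.δ) with hX
  refine ⟨q₀ + 3 + ⌈X⌉₊, ?_⟩
  intro q _ χ hq hχp hχq
  have hq₀ : q₀ ≤ q := by omega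
  have hq3 : (3 : ℕ) ≤ q := by omega
  have hqX : X ≤ q := by
    have h1 : X ≤ ⌈X⌉₊ := Nat.le_ceil X
    have h2 : (⌈X⌉₊ : ℝ) ≤ q := by exact_mod_cast (by omega : ⌈X⌉₊ ≤ q)
    exact h1.trans h2
  have hq1 : (1 : ℝ) < q := by exact_mod_cast (by omega : 1 < q)
  have hq0 : (0 : ℝ) < q := by positivity
  have hT0 : 0 < ρ.T q := by unfold Resonator.T; positivity
  have hmain := H q χ hq₀ hχp hχq
  -- `C q^{−δ/80} ≤ η δ₀`
  have hCX : 0 < C / (η * δ₀) := by positivity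
  have hpow : C * (q : ℝ) ^ (-(ρ.δ / 80)) ≤ η * δ₀ := by
    have h1 : C / (η * δ₀) ≤ (q : ℝ) ^ (ρ.δ / 80) := by
      have h2 : X ^ (ρ.δ / 80) ≤ (q : ℝ) ^ (ρ.δ / 80) :=
        Real.rpow_le_rpow (by positivity) hqX (by positivity)
      have h3 : X ^ (ρ.δ / 80) = C / (η * δ₀) := by
        rw [hX, ← Real.rpow_mul hCX.le, show (80 / ρ.δ) * (ρ.δ / 80) = 1 by field_simp,
          Real.rpow_one]
      rw [← h3]; exact h2
    have h4 : C ≤ η * δ₀ * (q : ℝ) ^ (ρ.δ / 80) := by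
      rw [div_le_iff₀ (by positivity)] at h1; linarith
    have h5 : (q : ℝ) ^ (ρ.δ / 80) * (q : ℝ) ^ (-(ρ.δ / 80)) = 1 := by
      rw [← Real.rpow_add hq0, add_neg_cancel, Real.rpow_zero]
    calc C * (q : ℝ) ^ (-(ρ.δ / 80))
        ≤ (η * δ₀ * (q : ℝ) ^ (ρ.δ / 80)) * (q : ℝ) ^ (-(ρ.δ / 80)) :=
          mul_le_mul_of_nonneg_right h4 (by positivity)
      _ = η * δ₀ := by rw [mul_assoc, h5, mul_one]
  -- `δ₀ ≤ (φ(q)/q) · log T` (since `δ₀/log log q < φ(q)/q` and `0 < log log q ≤ log q ≤ log T`)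
  have hφ := Hφ q hq3
  have hq3r : (3 : ℝ) ≤ q := by exact_mod_cast hq3
  have hlogq : 1 < Real.log q := by
    have h := Real.log_le_log (by norm_num) hq3r
    have h3 : 1 < Real.log 3 := by
      have := Real.log_two_gt_d9
      have h23 : Real.log 2 ≤ Real.log 3 := Real.log_le_log (by norm_num) (by norm_num)
      -- `log 3 > log 2 > 0.69`; use `exp 1 < 3`
      exact (Real.lt_log_iff_exp_lt (by norm_num)).mpr (by
        have := Real.exp_one_lt_d9; linarith)
    linarith
  have hll0 : 0 < Real.log (Real.log q) := Real.log_pos hlogq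
  have hllq : Real.log (Real.log q) ≤ Real.log q :=
    (Real.log_le_sub_one_of_pos (by linarith)).trans (by linarith)
  have hlogT : Real.log q ≤ Real.log (ρ.T q) := by
    unfold Resonator.T
    rw [Real.log_rpow hq0]
    have : 0 ≤ Real.log q := by linarith
    nlinarith
  have hφq0 : 0 ≤ (Nat.totient q : ℝ) / q := by positivity
  have hδ₀le : δ₀ ≤ (Nat.totient q : ℝ) / q * Real.log (ρ.T q) := by
    have h1 : δ₀ < (Nat.totient q : ℝ) / q * Real.log (Real.log q) := by
      rw [div_lt_iff₀ hll0] at hφ; linarith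
    have h2 : (Nat.totient q : ℝ) / q * Real.log (Real.log q) ≤
        (Nat.totient q : ℝ) / q * Real.log (ρ.T q) :=
      mul_le_mul_of_nonneg_left (hllq.trans hlogT) hφq0
    linarith
  -- assemble
  have hexp : (q : ℝ) ^ (ρ.δ / 80) * (q : ℝ) ^ (-(ρ.δ / 40)) = (q : ℝ) ^ (-(ρ.δ / 80)) := by
    rw [← Real.rpow_add hq0]
    exact congrArg (fun t : ℝ => (q : ℝ) ^ t) (by ring)
  calc |offDiagOD c w B ρ χ|
      ≤ C * (q : ℝ) ^ (ρ.δ / 80) * ρ.T q * (q : ℝ) ^ (-(ρ.δ / 40)) := hmain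
    _ = ρ.T q * (C * ((q : ℝ) ^ (ρ.δ / 80) * (q : ℝ) ^ (-(ρ.δ / 40)))) := by ring
    _ = ρ.T q * (C * (q : ℝ) ^ (-(ρ.δ / 80))) := by rw [hexp]
    _ ≤ ρ.T q * (η * δ₀) := mul_le_mul_of_nonneg_left hpow hT0.le
    _ ≤ ρ.T q * (η * ((Nat.totient q : ℝ) / q * Real.log (ρ.T q))) :=
        mul_le_mul_of_nonneg_left (mul_le_mul_of_nonneg_left hδ₀le hη.le) hT0.le
    _ = η * (ρ.T q * ((Nat.totient q : ℝ) / q) * Real.log (ρ.T q)) := by ring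

end Literature.NumberTheory.LFunctions.BondarenkoHeap2026
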